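import Literature.MathematicalPhysics.QuantumFieldTheory.Balaban1983to89.B9ThmDCommutatorStepAdj
import Literature.MathematicalPhysics.QuantumFieldTheory.Balaban1983to89.B9Eq3105FamThreeLocDiffGRight
import Literature.MathematicalPhysics.QuantumFieldTheory.Balaban1983to89.B9Eq3105FamThreeCommStepMember

/-!
# `Balaban1983to89.B9Eq3105FamThreeCommStepAdjAtDatum` — FAMILY 3 OF (3.105): THE ADJOINT-ORDERED COMMUTATOR LETTER `T_χ = G′_□·[Δ′_{a,□}, M_{χ_□}]` AT THE (3.35)
# DATUM AND ON THE MEMBER's CARRIER — F3-E3's displayed input `hGK` SUPPLIED, hence the right-located `G′`-difference entry `hDR □ ν` with `hGK` DISCHARGED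
# (sub-row G-B9-LETTERS, GAPS G-B9-05 ∕ G-B9-p33-01, programme FAMTHREE FILE F3-E3c; design `lit-balaban-p38/F3E3b-SCOPE.md`; lead g35 RULING FAMTHREE-5a (4);
# seat p38 gen 48)

T. Bałaban, *Propagators for lattice gauge theories in a background field*, Commun. Math. Phys. **99** (1985) 389–434 [`Balaban1985BackgroundPropagators`, "[B9]"];
[4] = T. Bałaban, *Propagators and renormalization transformations for lattice gauge theories. II*, Commun. Math. Phys. **96** (1984) 223–250 [`Balaban1984PropagatorsII`];
[2] of [B9] = T. Bałaban, *Regularity and decay of lattice Green's functions*, Commun. Math. Phys. **89** (1983) 571–597 [`Balaban1983RegularityDecay`].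

statement-level skeleton of published theorems with citation tags; proofs where landed; nothing here is a claim about the Yang–Mills mass gap

THE PRINTED LOCUS (held `paper:balaban1985-cmp99-background-propagators`, journal page = PDF page + 388).  p. 415 l. 29–31 «Next we replace the operators G′_{□₀} and
C_{□₀} by G′_□, C_□, terms with the differences G′_{□₀} − G′_□ and C_{□₀} − C_□ are small by the same reason as before»; p. 412 l. 1–9 and l. 22–36 («the
operators may differ outside □̃₀, and the distance from □̃ to □̃₀ᶜ is at least M»); (3.88)–(3.89) p. 409 (the commutator letter, «O(M⁻¹) when composed with G′_□»);
Cor. 3.6 p. 408 («U′ = U^u = e^{iηA}», the localised field; «The operators constructed for this sequence … satisfy all the inequalities of Theorems 3.1–3.3» p. 409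
l. 1–5); Thm 3.1 (3.42) p. 397; Thm 3.4 p. 400; (3.24)–(3.25) p. 394; (3.31)–(3.33) pp. 395–396 (gauge covariance); (3.37) p. 396; (3.59) p. 402; (3.100) p. 413;
[4] (2.51)–(2.55) pp. 232–233, (2.46) p. 231, Lemma 2.1 (2.60)–(2.61) p. 234, (2.83)–(2.85) pp. 237–238, p. 247; [2] (1.11)–(1.12) (statement type only).

WHY THIS FILE.  p38 g47's F3-E3 `B9Eq3105FamThreeLocDiffGRight.hasMajorant_hDR_at` proves the right-located entry `hDR □ ν` of family 3 modulo ONE displayed input,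
`hGK`: the member-carrier kernel `θ_K·e^{−b_Kδ₀d}` of `conj b(T_χ^ℝ)`, `T_χ = G′_□(V′)·(Δ′_□(V′)M_{χ_□} − M_{χ_□}Δ′_□(V′))`, `V′ = Ṽ_□^{u⁻¹}`.  FILE E3b
(`B9ThmDCommutatorStepAdj.hasMajorant_conj_commStepAdj`) bounds `conj b(T_χ(V)^ℝ)` over the CUBE SEQUENCE's blocks at a generic `(par, V)` from the cube's (3.42)
entries.  THIS FILE (the twin of p33's E2e `B9Eq3105FamThreeCommStepAtDatum` + E2b `B9Eq3105FamThreeCommStepMember` for the other order) does the three remaining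
steps: §2 reads E3b AT THE DATUM `Ṽ_□ = locCfgY i □ η_k A` from p33 7b-C's cube packages — entry 0 and the COLUMN entries (3.42)₃ (`gp_cube_entries_at_locCfg`, first
and fourth conjuncts), the (3.37) reading of the cut field (`gp_cube_at_locCfg`, giving E3b's rotation bound `κ_V = 9∕4` via `norm_mulDefF_apply_le`) and its (3.59)
sizes — with `hST_geoCK` (the transfers of `ℓ⁻¹`, `ℓ⁻²`) and `exists_h261_geoCK`, packaged over all members above one threshold (`commStepAdj_at_datum`, the
cube-side `hT □`); §1∕§3 move it to `V′ = Ṽ_□^{u⁻¹}` by covariance and to the member's site carrier with global sources AND global rows by p21 g58's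
`hasMajorant_conj_site_sandwich_src_global` with the trivial row multiplier (E3b's kernel is `ℓ`-free, so no annulus indicator is needed) — this IS `hGK`; §4 plugs it
into F3-E3: `hasMajorant_hDR_at_of_cube` = `hDR □ ν` with `hGK` DISCHARGED, displayed now exactly like p33 E2d's `hDL` supplier (`hE`, the cube-side letter at `Ṽ_□`,
the units, the datum, the transfers, the two (2.61)'s and the budgets).

WHAT THIS FILE CERTIFIES (kernel-checked; 0 `def`, 0 `def … : Prop`, 0 sorry; standard axioms only)
* §1 ★ `commStepAdj_gauge_inv_eq` — `T_χ(V^{g⁻¹}) = R(g)⁻¹·T_χ(V)·R(g)` (F3-E1 `deltaPrimeACubeY_gauge_inv_eq`, E2b `GpCubeY_gauge_inv_eq` BY NAME).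
* §2 ★ `norm_R_UboxY_locCfgY_le` (`‖R(Ṽ_{□,ν}(z))a‖ ≤ (9∕4)‖a‖` under the (3.37) reading, `α₁ ≤ 1∕4`), ★★ `commStepAdj_at_datum` — ∃ `δ_T > 0`, `θ_T ≥ 0`, thresholds
  `M₀, T₀, N₀`, `a₁ > 0` (functions of `d, L, M₂, Σ‖b_j‖`) such that for every member above the thresholds, every cube, all `Rr, H`, every `g, U` and (3.35) datum with
  `α₁ ≤ a₁, 1∕4`: `IsUnit Δ′_{a,□}(Ṽ_□)` and `conj b((G′_□(Ṽ_□)(Δ′_□(Ṽ_□)M_{χ_□} − M_{χ_□}Δ′_□(Ṽ_□)))^ℝ) ≺ θ_T·e^{−δ_Td_□}` over `(toB6 (geoCK i □) Rr H, blkCubeY)`,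
  `δ_T = (1 − 1∕2)(1 − 9∕5000)δ_e`.
* §3 `cutMulY_one_eq`, ★★ `hasMajorant_conj_commStepAdj_member` (`conj b(T_χ(V^{g⁻¹})^ℝ) ≺ (M₂Σ‖b_j‖)²θc₁(dB, δ, α)·e^{−(1−α)δ·d}` over `(toB6 (geo9K i) Rr′ Hp, ιB∘blkOf)`
  from a cube-side `θe^{−δd_□}`, a bi-contractive `g`, the cube (2.61) at `(δ, α)`), ★★ `hasMajorant_conj_commStepAdj_member_rate` (the same at F3-E3's letters:
  kernel `((M₂Σ‖b_j‖)²θc₁)·e^{−b_Kδ₀·d}` for `b_K·δ₀ ≤ (1−α)δ` — LITERALLY F3-E3's `hGK` binder shape with `θ_K := (M₂Σ‖b_j‖)²θc₁`).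
* §4 ★★★ `hasMajorant_hDR_at_of_cube` — F3-E3's `hasMajorant_hDR_at` with `hGK` DISCHARGED: displayed `hE` (the inverse-family `EBlock` of `G′(U₁)`), the cube-side
  `hT` at `Ṽ_□` (§2), bi-contractive `u_□`, `IsUnit Δ′_a(U₁)`, `IsUnit Δ′_{a,□}(Ṽ_□^{u⁻¹})`, `η = |c_f|⁻¹`, the (3.35) datum, [4] (2.60) for `ℓ` (twice), the cube (2.61)
  at `(δ_c, α_c)`, the member (2.61) at `(δ₀, a_G − α − a_sep − ρ)`, and the budgets `α + a_sep + ρ ≤ a_G`, `a_Gδ₀ ≤ δ_G`, `α_st + ρ ≤ b_K`, `b_Kδ₀ ≤ (1−α_c)δ_c`.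

HONEST SCOPE ∕ NOT CLAIMED.  A repackaging ∕ transfer ∕ plug of landed results (E3b, p33's cube packages, p21 g58's transfer, p38 F3-E3); no new inequality of [B9]
beyond them; `𝔸` with `‖1‖ = 1` in §2.  The smallness of `hDR` is F3-E3's collar factor, not print's `O(M⁻¹)` (not claimed).  What family 3 of (3.105) still displays
after this file: `hP3` (D2, p33's F3-B3 FILES 2–4), the cube-side letters `hR □` (p33 E2e) and `hT □` (§2 here) — both SUPPLIED over all members above one threshold —,
the letters' blocks `hE`∕`hEO`∕`hCinv`, the units, the (3.35) datum, transfers, (2.61)'s and budgets (the ∃-packaging is the assembler's, p33's FILE 5).  Count-neutral;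
NOT a node discharge; no summit ∕ sub-problem statement is proved; nothing continuum ∕ OS ∕ mass-gap ∕ Clay; YM mass gap NOT proved (Track A conditional rung).  No
`sorry`, no `axiom`, no `… : Prop` fact, no `instance`, no `notation`, no `def`.  NEW file; nothing landed is modified.  Cell `lit-balaban`, seat `lit-balaban-p38` gen
48, 2026-08-29; `--supports stmt-QuantumFields-19200` as helper.  Net new unproved facts: 0.

RELATED IN THE TREE, NOT DUPLICATED (searched 2026-08-29: `rg 'commStepAdj|hDR_at_of_cube|norm_R_UboxY_locCfgY' Literature/` = E3b only): p33 E2e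
`B9Eq3105FamThreeCommStepAtDatum.commStep_at_datum` ∕ E2b `B9Eq3105FamThreeCommStepMember.hasMajorant_conj_commStep_member` ∕ E2d
`B9Eq3105FamThreeLocDiffGOfEBlock.hasMajorant_commStep_member_rate` (the other order — the patterns followed line by line), p21 D6 `B9ThmDAtDatum` (the two-package
threshold bookkeeping), p21 g58 `B9Cor36SiteSandwichTransferSrcGlobal`, p38 F3-E3 `B9Eq3105FamThreeLocDiffGRight` — all USED BY NAME.
-/

noncomputable section

namespace Literature.MathematicalPhysics.QuantumFieldTheory.Balaban1983to89.B9Eq3105FamThreeCommStepAdjAtDatum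

open NormedSpace Complex
open B6RandomWalk (HasMajorant hasMajorant_mono Ineq261 c1_nonneg)
open B9FromB6 (EBlock)
open B9Thm34Ext (toB6)
open B4PartitionUnity22 (thetaProf D1 D2 D1_nonneg D2_nonneg contDiff_thetaProf hasCompactSupport_thetaProf)
open B6KLevelCensusIndexV1 (KIdx kGeo)
open B6Cover236MultiLevelBlocks (cubes)
open B6GlobalChartV1 (PV boxEquiv)
open B6Geom246MultiLevelBox (blkOf)
open B6Ineq2142KLevelV1 (β)
open B9GeoNormsKLevelV1 (geo9K)
open B9Ineq347 (ScaleTransfer)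
open B9Eq352DivFormLetters (conj)
open B9Eq352GradLetters (diffLetter)
open B9Eq39Adjoint (R fluct covD)
open B9Eq310Hermitian (norm_R_le norm_R_inv_le)
open B9Eq360DeltaPrimeAY (AfldY chartA)
open B9Eq360DeltaPrimeACubeY (blkCubeY kFCubeY sFCubeY)
open B9BackgroundsKLevelV1 (shiftsV1)
open B9CubeLettersOpsL0 (deltaPrimeACubeY GpCubeY)
open B9CubeLettersBondOpsL0 (BlkCubeY)
open B9CubeGeometryInputs (geoCK geoCK_eta geoCK_eta_pos geoCK_len_pos geoCK_eta_le_len geoCK_dist_axioms RM1 N1 exists_h261_geoCK hST_geoCK)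
open B9Cor35GpCubeInputsAtOne (wK)
open B9Cor36CubeCutoffs (SC NearC chiY chiTY locCfgY)
open B9Cor36CutoffField337 (bumpY cutFldY)
open B9Cor36CubeCutoffs (ctrR)
open B9Eq359CubeKernelsAtOne (Cq Cq_nonneg)
open B9Cor36GpCubeExtAtV (GpVK gp_cube_at_locCfg)
open B9Cor36GpCubeEntriesAtV (gp_cube_entries_at_locCfg mulDefF_apply norm_mulDefF_apply_le)
open B9Cor36GpCubeLocLetter (conjY_inv_mul_conjY conjY_mul_conjY_inv cutMulY_mul_conjY)
open B9Cor36SiteSandwichTransferSrcGlobal (hasMajorant_conj_site_sandwich_src_global)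
open B9CubeLettersInvReadings (kernelFamilySInv)
open B9Thm37CubeCoverCommutators (cutMulY cutMulY_apply)
open B9ThmDCommutatorStepAdj (hasMajorant_conj_commStepAdj)
open B9Eq3105FamThreeLocDiffG (deltaPrimeACubeY_gauge_inv_eq)
open B9Eq3105FamThreeCommStepMember (GpCubeY_gauge_inv_eq)
open B9Eq3105FamThreeLocDiffGRight (hasMajorant_hDR_at)
open B9Eq3105FamTwoCore (geo9K_axioms)
open Node00 (SiteY BlkY IBondY CfgY GaugeY SiteParY toKT etaS shiftY UboxY gaugeY gSiteY conjY parSymY IsGaugeLawS parSymY_one parSymY_isGaugeLawS GpY deltaPrimeAY)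

variable {d ℓ : ℕ} {hd : 1 ≤ d + 1} {hL : Odd (ℓ + 1) ∧ 1 < ℓ + 1} {b₀ b₁ : ℝ}
variable {𝔸 : Type} [NormedRing 𝔸] [NormedAlgebra ℂ 𝔸] [CompleteSpace 𝔸]
variable {ι : Type} [Fintype ι]

/-! ## §1  Covariance of the adjoint-ordered commutator letter -/

section Covariance

variable (i : KIdx d ℓ hd hL b₀ b₁) (c : ↥(cubes (toKT i).D.toDomains))

/-- ★ **`T_χ(V^{g⁻¹}) = R(g)⁻¹·T_χ(V)·R(g)`** for `T_χ(W) = G′_□(W)·(Δ′_{a,□}(W)M_{χ_□} − M_{χ_□}Δ′_{a,□}(W))` (`M_{χ_□}` commutes with `R(g)`; (3.31)–(3.33)).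
[cite: Balaban1985BackgroundPropagators, (3.31)–(3.33) pp.395–396, (3.88) p.409, Cor. 3.6 p.408] -/
theorem commStepAdj_gauge_inv_eq {parS : SiteParY 𝔸 i} (hS : IsGaugeLawS i parS) (g : GaugeY 𝔸 i) (V : CfgY 𝔸 i) :
    GpCubeY i c parS (gaugeY i g⁻¹ V) *
        (deltaPrimeACubeY i c parS (gaugeY i g⁻¹ V) * cutMulY (𝔸 := 𝔸) (chiY i c) - cutMulY (𝔸 := 𝔸) (chiY i c) * deltaPrimeACubeY i c parS (gaugeY i g⁻¹ V)) =
      conjY (gSiteY i g)⁻¹ * (GpCubeY i c parS V *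
        (deltaPrimeACubeY i c parS V * cutMulY (𝔸 := 𝔸) (chiY i c) - cutMulY (𝔸 := 𝔸) (chiY i c) * deltaPrimeACubeY i c parS V)) * conjY (gSiteY i g) := by
  rw [deltaPrimeACubeY_gauge_inv_eq i c hS g V, GpCubeY_gauge_inv_eq i c hS g V]
  set Γ : Module.End ℂ (SiteY i → 𝔸) := conjY (gSiteY i g)
  set Γi : Module.End ℂ (SiteY i → 𝔸) := conjY (gSiteY i g)⁻¹
  set C : Module.End ℂ (SiteY i → 𝔸) := cutMulY (𝔸 := 𝔸) (chiY i c)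
  set Δ : Module.End ℂ (SiteY i → 𝔸) := deltaPrimeACubeY i c parS V
  set G : Module.End ℂ (SiteY i → 𝔸) := GpCubeY i c parS V
  have e1 : C * Γi = Γi * C := cutMulY_mul_conjY i _ _
  have e2 : C * Γ = Γ * C := cutMulY_mul_conjY i _ _
  have hΓΓi : Γ * Γi = 1 := conjY_mul_conjY_inv i (gSiteY i g)
  have s1 : C * (Γi * Δ * Γ) = Γi * (C * Δ) * Γ := by rw [← mul_assoc, ← mul_assoc, e1, mul_assoc Γi C Δ]
  have s2 : Γi * Δ * Γ * C = Γi * (Δ * C) * Γ := by rw [mul_assoc (Γi * Δ) Γ C, ← e2, ← mul_assoc, mul_assoc Γi Δ C]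
  rw [s1, s2, ← sub_mul, ← mul_sub]
  calc Γi * G * Γ * (Γi * (Δ * C - C * Δ) * Γ) = Γi * G * (Γ * Γi) * (Δ * C - C * Δ) * Γ := by simp only [mul_assoc]
    _ = _ := by rw [hΓΓi, mul_one]; simp only [mul_assoc]

end Covariance

/-! ## §2  E3b's cube-carrier majorant AT THE (3.35) DATUM, packaged over all members above one threshold and all cubes -/

section Datum

variable [NormOneClass 𝔸] (i : KIdx d ℓ hd hL b₀ b₁) (c : ↥(cubes (toKT i).D.toDomains))

/-- ★ **THE ROTATIONS OF THE LOCALISED FIELD ARE `9∕4`-BOUNDED**: under the (3.37) reading `‖Ã_k(x)‖ ≤ α₁(L^{n(x)}η)⁻¹`, `α₁ ≤ 1∕4`, of the cut field,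
`‖R(Ṽ_{□,ν}(z))a‖ ≤ (9∕4)‖a‖` (`‖R(W)a − a‖ ≤ 5·ηα₁(Lⁿη)⁻¹‖a‖ ≤ (5∕4)‖a‖` by p33's `norm_mulDefF_apply_le`, `η ≤ Lⁿη`) — E3b's `κ_V`.
[cite: Balaban1985BackgroundPropagators, (3.37) p.396, p.403 l.1–9, Cor. 3.6 p.408] -/
theorem norm_R_UboxY_locCfgY_le (A : AfldY 𝔸 i) {α₁ : ℝ} (hα₁0 : 0 ≤ α₁) (hα4 : α₁ ≤ 1 / 4)
    (hA : ∀ k x, ‖chartA i (cutFldY i (chiTY i c) A) k x‖ ≤ α₁ * ((geoCK i c).len (blkCubeY i c x))⁻¹) (ν : Fin (d + 1)) (z : SiteY i) (a : 𝔸) :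
    ‖R (UboxY i (locCfgY i c (kGeo i).eta A) ν z) a‖ ≤ 9 / 4 * ‖a‖ := by
  have hη : 0 < (kGeo i).eta := by rw [← geoCK_eta i c]; exact geoCK_eta_pos i c
  have hlen := geoCK_len_pos i c (blkCubeY i c z)
  have hηlen : (kGeo i).eta ≤ (geoCK i c).len (blkCubeY i c z) := by rw [← geoCK_eta i c]; exact geoCK_eta_le_len i c _
  have h := norm_mulDefF_apply_le i c A hα₁0 hα4 hA ν (fun _ => a) z
  rw [mulDefF_apply, norm_smul, norm_inv, Complex.norm_real, Real.norm_eq_abs, abs_of_pos hη] at h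
  have h1 : ‖R (UboxY i (locCfgY i c (kGeo i).eta A) ν z) a - a‖ ≤ 5 / 4 * ‖a‖ := by
    have h2 : ‖R (UboxY i (locCfgY i c (kGeo i).eta A) ν z) a - a‖ ≤ (kGeo i).eta * (5 * α₁ * ((geoCK i c).len (blkCubeY i c z))⁻¹ * ‖a‖) := by
      rw [← div_le_iff₀' hη, div_eq_inv_mul]; exact h
    have h3 : (kGeo i).eta * ((geoCK i c).len (blkCubeY i c z))⁻¹ ≤ 1 := by
      rw [← div_eq_mul_inv, div_le_one hlen]; exact hηlen
    calc ‖R (UboxY i (locCfgY i c (kGeo i).eta A) ν z) a - a‖ ≤ (kGeo i).eta * (5 * α₁ * ((geoCK i c).len (blkCubeY i c z))⁻¹ * ‖a‖) := h2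
      _ = 5 * α₁ * ((kGeo i).eta * ((geoCK i c).len (blkCubeY i c z))⁻¹) * ‖a‖ := by ring
      _ ≤ 5 * (1 / 4) * 1 * ‖a‖ := by
          have ha := norm_nonneg a
          have h4 : 0 ≤ (kGeo i).eta * ((geoCK i c).len (blkCubeY i c z))⁻¹ := mul_nonneg hη.le (inv_nonneg.2 hlen.le)
          exact mul_le_mul_of_nonneg_right (mul_le_mul (by linarith) h3 h4 (by positivity)) ha
      _ = 5 / 4 * ‖a‖ := by ring
  calc ‖R (UboxY i (locCfgY i c (kGeo i).eta A) ν z) a‖ = ‖(R (UboxY i (locCfgY i c (kGeo i).eta A) ν z) a - a) + a‖ := by rw [sub_add_cancel]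
    _ ≤ ‖R (UboxY i (locCfgY i c (kGeo i).eta A) ν z) a - a‖ + ‖a‖ := norm_add_le _ _
    _ ≤ 5 / 4 * ‖a‖ + ‖a‖ := add_le_add h1 le_rfl
    _ = 9 / 4 * ‖a‖ := by ring

variable [DecidableEq ι] (b : Module.Basis ι ℝ 𝔸)

set_option maxHeartbeats 1600000 in
/-- ★★ **THE ADJOINT-ORDERED COMMUTATOR LETTER AT THE DATUM** (the cube-side `hT □` of the `hGK` supplier): ∃ `δ_T > 0`, `θ_T ≥ 0`, thresholds `M₀, T₀, N₀` and Thm 3.4's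
`a₁ > 0` (functions of `d, L`, the basis datum `M₂, Σ‖b_j‖`) such that for every member above the thresholds, every cover cube `□`, all letters `Rr, H`, every gauge `g`,
field `U` and (3.35) cube datum `(A, Q, C, ξ, Λ)` with `α₁ = max C (C(1+D₁θ))Λ² ≤ a₁, 1∕4`: `IsUnit Δ′_{a,□}(Ṽ_□)` and
`conj b((G′_□(Ṽ_□)·(Δ′_{a,□}(Ṽ_□)M_{χ_□} − M_{χ_□}Δ′_{a,□}(Ṽ_□)))^ℝ) ≺ θ_T·e^{−δ_Td_□}` over `(toB6 (geoCK i □) Rr H, blkCubeY)`, `Ṽ_□ = locCfgY i □ η_k A` — E3b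
`hasMajorant_conj_commStepAdj` fed by p33's cube packages (entry 0 and the COLUMN entries (3.42)₃ of `gp_cube_entries_at_locCfg`; the (3.37) reading and the (3.59) sizes
of `gp_cube_at_locCfg`), `κ_V = 9∕4`, `hST_geoCK` (the transfers of `ℓ⁻¹`, `ℓ⁻²` at exponent `9∕5000`), `exists_h261_geoCK` ((2.61) at `((1 − 9∕5000)δ_e, 1∕2)`);
`δ_T = (1 − 1∕2)(1 − 9∕5000)δ_e`. The twin of p33 E2e `commStep_at_datum`.
[cite: Balaban1985BackgroundPropagators, (3.88)–(3.89) p.409, (3.100) p.413, Cor. 3.6 p.408, Thm 3.1 (3.42) p.397, Thm 3.4 p.400, (3.24) p.394, (3.37) p.396, (3.59) p.402; Balaban1984PropagatorsII, (2.51)–(2.55) pp.232–233, Lemma 2.1 (2.60)–(2.61) p.234, p.247] -/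
theorem commStepAdj_at_datum (d ℓ : ℕ) (hℓ : 1 ≤ ℓ) {M₂ : ℝ} (hM₂ : 0 ≤ M₂) (hrepr : ∀ (v : 𝔸) (j : ι), |b.repr v j| ≤ M₂ * ‖v‖) :
    ∃ δT θT M₀ T₀ : ℝ, ∃ N₀ : ℕ, 0 < δT ∧ 0 ≤ θT ∧ ∃ a₁ : ℝ, 0 < a₁ ∧
    ∀ {hd : 1 ≤ d + 1} {hL : Odd (ℓ + 1) ∧ 1 < ℓ + 1} {b₀ b₁ : ℝ} (i : KIdx d ℓ hd hL b₀ b₁) (c : ↥(cubes (toKT i).D.toDomains)) (Rr : ℝ) (H : Prop),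
      M₀ ≤ ((ℓ : ℝ) + 1) * (toKT i).Mh → N₀ + 1 ≤ (toKT i).R * ((ℓ + 1) * (toKT i).Mh) → T₀ ≤ RM1 i →
    ∀ (g : GaugeY 𝔸 i) (U : CfgY 𝔸 i) (A : AfldY 𝔸 i) (Q : Set (Site (PV d ℓ i.m i.K hd hL) 0)) (C ξ Λ : ℝ),
      0 ≤ C → 0 < ξ → 1 ≤ Λ → ξ ≤ 5 * (SC i c : ℝ) * (kGeo i).eta → LatticeNorms.scaleLen ((ℓ : ℝ) + 1) (kGeo i).eta (c.1.1 + 1) ≤ Λ * ξ →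
      (∀ x : Site (PV d ℓ i.m i.K hd hL) 0, NearC i c (35 * SC i c / 8 + 1) (boxEquiv i.hN x).1 → x ∈ Q) →
      (∀ (κ : Fin (d + 1)) (x : Site (PV d ℓ i.m i.K hd hL) 0), x ∈ Q → x.shift κ ∈ Q → gaugeY i g U κ x = fluct (kGeo i).eta A κ x) →
      (∀ κ, ∀ x ∈ Q, ‖A κ x‖ ≤ C * ξ⁻¹) →
      (∀ μ ν, ∀ x ∈ Q, ‖(((kGeo i).eta : ℂ)⁻¹) • covD (shiftsV1 (PV d ℓ i.m i.K hd hL)) (fun _ _ => (1 : 𝔸ˣ)) μ (A ν) x‖ ≤ C * (ξ ^ 2)⁻¹) →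
      max C (C * (1 + D1 thetaProf)) * Λ ^ 2 ≤ a₁ → max C (C * (1 + D1 thetaProf)) * Λ ^ 2 ≤ 1 / 4 →
      IsUnit (deltaPrimeACubeY i c (parSymY i) (locCfgY i c (kGeo i).eta A)) ∧
      HasMajorant (g := toB6 (geoCK i c) Rr H) (fun p : SiteY i × ι => blkCubeY i c p.1)
        (conj b ((GpCubeY i c (parSymY i) (locCfgY i c (kGeo i).eta A) *
            (deltaPrimeACubeY i c (parSymY i) (locCfgY i c (kGeo i).eta A) * cutMulY (𝔸 := 𝔸) (chiY i c) -
              cutMulY (𝔸 := 𝔸) (chiY i c) * deltaPrimeACubeY i c (parSymY i) (locCfgY i c (kGeo i).eta A))).restrictScalars ℝ))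
        (fun a a' => θT * Real.exp (-(δT * (geoCK i c).dist a a'))) := by
  have h1A : ‖(1 : 𝔸)‖ ≤ 1 := norm_one.le
  have hD1 := D1_nonneg contDiff_thetaProf hasCompactSupport_thetaProf
  have hD2 := D2_nonneg contDiff_thetaProf hasCompactSupport_thetaProf
  have hSb : 0 ≤ ∑ j, ‖b j‖ := Finset.sum_nonneg fun _ _ => norm_nonneg _
  have hMS : 0 ≤ M₂ * ∑ j, ‖b j‖ := mul_nonneg hM₂ hSb
  have hL4 : (0 : ℝ) ≤ ((ℓ : ℝ) + 1) ^ 4 := by positivity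
  -- the two cube packages (p33 7b-C and its base)
  obtain ⟨δe, Bf, M₀e, T₀e, N₀e, hδe, hBf, a₁e, ha₁e, HE⟩ := gp_cube_entries_at_locCfg b d ℓ hℓ M₂ hM₂ hrepr
  obtain ⟨δx, BGx, M₀x, T₀x, N₀x, hδx, hBGx, a₁x, ha₁x, Bx, hBx, HX⟩ := gp_cube_at_locCfg b d ℓ hℓ M₂ hM₂ hrepr
  -- the exponents: transfers at `a₀ = 9/5000`, the chain split at `1/2`
  set a₀ : ℝ := 9 / 5000 with ha₀def
  have ha₀0 : 0 < a₀ := by rw [ha₀def]; norm_num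
  have ha₀1 : a₀ ≤ 1 := by rw [ha₀def]; norm_num
  have hσ : 0 < (1 - a₀) * δe := by rw [ha₀def]; positivity
  obtain ⟨dB, h261C⟩ := exists_h261_geoCK d ℓ hσ
  -- the uniform constant
  set θT : ℝ := ((d : ℝ) + 1) * (Bf * (D1 thetaProf / 4) * ((ℓ : ℝ) + 1) ^ 4 * (M₂ * (∑ j, ‖b j‖) * (9 / 4) * Real.exp ((1 - a₀) * δe)) *
        B6.c1 dB ((1 - a₀) * δe) (1 / 2) ^ 2 + Bf * (D1 thetaProf / 4) * ((ℓ : ℝ) + 1) ^ 4) +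
      Bf * (((d : ℝ) + 1) * (3 * D2 thetaProf / 16)) * ((ℓ : ℝ) + 1) ^ 4 + Bf * (2 * (1 + Cq d * (1 / 4)) ^ 2 * (M₂ * ∑ j, ‖b j‖)) * ((ℓ : ℝ) + 1) ^ 4
    with hθTdef
  have hc1 : 0 ≤ B6.c1 dB ((1 - a₀) * δe) (1 / 2) := c1_nonneg _ _ _
  have hθT : 0 ≤ θT := by rw [hθTdef]; have := Cq_nonneg d; positivity
  refine ⟨(1 - 1 / 2) * ((1 - a₀) * δe), θT, max M₀e M₀x, max (max T₀e T₀x) (4 * Real.log ((ℓ : ℝ) + 1) / (9 / 5000 * δe)),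
    max (max N₀e N₀x) (N1 d ℓ (9 / 5000 * ((1 - a₀) * δe))), by positivity, hθT, min a₁e a₁x, lt_min ha₁e ha₁x, ?_⟩
  intro hd hL b₀ b₁ i c Rr H hM hN hT g U A Q C ξ Λ hC0 hξ hΛ hξS hΛξ hQ hgA hAf hdA hα₁ hα4
  have hMe : M₀e ≤ ((ℓ : ℝ) + 1) * (toKT i).Mh := (le_max_left _ _).trans hM
  have hMx : M₀x ≤ ((ℓ : ℝ) + 1) * (toKT i).Mh := (le_max_right _ _).trans hM
  have hTe : T₀e ≤ RM1 i := ((le_max_left _ _).trans (le_max_left _ _)).trans hT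
  have hTx : T₀x ≤ RM1 i := ((le_max_right _ _).trans (le_max_left _ _)).trans hT
  have hT₁ : 4 * Real.log ((ℓ : ℝ) + 1) / (9 / 5000 * δe) ≤ RM1 i := (le_max_right _ _).trans hT
  have hNe : N₀e + 1 ≤ (toKT i).R * ((ℓ + 1) * (toKT i).Mh) := le_trans (Nat.succ_le_succ ((le_max_left _ _).trans (le_max_left _ _))) hN
  have hNx : N₀x + 1 ≤ (toKT i).R * ((ℓ + 1) * (toKT i).Mh) := le_trans (Nat.succ_le_succ ((le_max_right _ _).trans (le_max_left _ _))) hN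
  have hN₁ : N1 d ℓ (9 / 5000 * ((1 - a₀) * δe)) + 1 ≤ (toKT i).R * ((ℓ + 1) * (toKT i).Mh) := le_trans (Nat.succ_le_succ (le_max_right _ _)) hN
  have hα₁0 : 0 ≤ max C (C * (1 + D1 thetaProf)) * Λ ^ 2 := mul_nonneg (le_max_of_le_left hC0) (sq_nonneg _)
  -- the packages at this member ∕ cube
  obtain ⟨hunit, hGV, -, hGDb, -⟩ := HE i c Rr H hMe hNe hTe g U A Q C ξ Λ hC0 hξ hΛ hξS hΛξ hQ hgA hAf hdA (hα₁.trans (min_le_left _ _)) hα4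
  obtain ⟨-, -, -, ⟨r4, -, hkF, hsF⟩, -, -⟩ := HX i c Rr H hMx hNx hTx g U A Q C ξ Λ hC0 hξ hΛ hξS hΛξ hQ hgA hAf hdA (hα₁.trans (min_le_right _ _)) hα4
  refine ⟨hunit, ?_⟩
  -- the geometric inputs of E3b
  obtain ⟨-, -, hST3, hST4, -, -⟩ := hST_geoCK i c hδe hT₁ a₀ (le_of_eq ha₀def.symm)
  have h261 : Ineq261 dB (toB6 (geoCK i c) Rr H) ((1 - a₀) * δe) (1 / 2) := h261C i c Rr H hN₁ _ (by norm_num) (by norm_num)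
  have hRV := norm_R_UboxY_locCfgY_le i c A hα₁0 hα4 r4
  -- E3b
  have hT₀ := hasMajorant_conj_commStepAdj i c b (parSymY i) (locCfgY i c (kGeo i).eta A) hM₂ hrepr h1A Rr H (fun z w => parSymY_one i z w)
    (by norm_num : (0 : ℝ) ≤ 9 / 4) hRV (Cq_nonneg d) hα₁0 hkF hsF hBf hδe.le ha₀1 (by norm_num : (0 : ℝ) ≤ 1 / 2) (by norm_num : (1 : ℝ) / 2 ≤ 1)
    hL4 hL4 dB (fun a e => hST3 a e) (fun a e => hST4 a e) h261 hGV hGDb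
  refine hasMajorant_mono (g := toB6 (geoCK i c) Rr H) _ hT₀ fun a a' => mul_le_mul_of_nonneg_right ?_ (Real.exp_nonneg _)
  -- the uniform constant: `(1 + C_qα₁)² ≤ (1 + C_q∕4)²`
  rw [hθTdef]
  set Cqd : ℝ := Cq d with hCqd
  set α₁ : ℝ := max C (C * (1 + D1 thetaProf)) * Λ ^ 2 with hα₁def
  have hCq : 0 ≤ Cqd := Cq_nonneg d
  have h0 : 0 ≤ 1 + Cqd * α₁ := add_nonneg zero_le_one (mul_nonneg hCq hα₁0)
  have h1 : 1 + Cqd * α₁ ≤ 1 + Cqd * (1 / 4) := by have := mul_le_mul_of_nonneg_left hα4 hCq; linarith only [this]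
  have hsq : (1 + Cqd * α₁) ^ 2 ≤ (1 + Cqd * (1 / 4)) ^ 2 := pow_le_pow_left₀ h0 h1 2
  have h3 : Bf * (2 * (1 + Cqd * α₁) ^ 2 * (M₂ * ∑ j, ‖b j‖)) * ((ℓ : ℝ) + 1) ^ 4 ≤ Bf * (2 * (1 + Cqd * (1 / 4)) ^ 2 * (M₂ * ∑ j, ‖b j‖)) * ((ℓ : ℝ) + 1) ^ 4 :=
    mul_le_mul_of_nonneg_right (mul_le_mul_of_nonneg_left (mul_le_mul_of_nonneg_right (mul_le_mul_of_nonneg_left hsq (by norm_num)) hMS) hBf) hL4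
  linarith only [h3]

end Datum

/-! ## §3  The source-global transfer to the member's site carrier: F3-E3's `hGK` shape -/

section Transfer

variable (i : KIdx d ℓ hd hL b₀ b₁) (c : ↥(cubes (toKT i).D.toDomains)) (b : Module.Basis ι ℝ 𝔸) [Fintype (geo9K i).Site] {Rr : ℝ} {H : Prop} {Rr' : ℝ} {Hp : Prop}

omit [CompleteSpace 𝔸] [Fintype (geo9K i).Site] in
/-- `M_1 = 1` (the trivial row multiplier of the source-global transfer). [cite: Balaban1984PropagatorsII, (2.52) p.232, bookkeeping] -/
theorem cutMulY_one_eq : (cutMulY (𝔸 := 𝔸) (fun _ : SiteY i => (1 : ℝ)) : Module.End ℂ (SiteY i → 𝔸)) = 1 := by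
  refine LinearMap.ext fun f => funext fun z => ?_
  rw [cutMulY_apply, Complex.ofReal_one, one_smul, Module.End.one_apply]

open Classical in
set_option maxHeartbeats 1600000 in
/-- ★★ **THE ADJOINT-ORDERED COMMUTATOR LETTER ON THE MEMBER's CARRIER, SOURCES AND ROWS GLOBAL**: from a cube-carrier majorant `conj b(T_χ(V)^ℝ) ≺ θ·e^{−δd_□}`
(E3b ∕ §2), a bi-contractive gauge `g` and the cube (2.61) at `(δ, α)`:  `conj b(T_χ(V^{g⁻¹})^ℝ) ≺ (M₂Σ‖b_j‖)²·(θ·c₁(dB, δ, α))·e^{−(1−α)δ·d(a,a′)}` over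
`(toB6 (geo9K i) Rr′ Hp, ιB∘blkOf)` — §1's covariance + p21 g58's `hasMajorant_conj_site_sandwich_src_global` with the trivial row multiplier `g₁ = 1` (no row cut-off is
needed: E3b's kernel is `ℓ`-free). The twin of p33 E2b `hasMajorant_conj_commStep_member`.
[cite: Balaban1985BackgroundPropagators, (3.88)–(3.89) p.409, p.412 l.22–36, (3.31)–(3.33) pp.395–396, Cor. 3.6 p.408; Balaban1984PropagatorsII, (2.51)–(2.52) p.232, (2.46) p.231, Lemma 2.1 (2.61) p.234] -/
theorem hasMajorant_conj_commStepAdj_member {M₂ : ℝ} (hM₂ : 0 ≤ M₂) (hrepr : ∀ (v : 𝔸) (j : ι), |b.repr v j| ≤ M₂ * ‖v‖)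
    {parS : SiteParY 𝔸 i} (hS : IsGaugeLawS i parS) (g : GaugeY 𝔸 i) (hg : ∀ x, ‖((g x : 𝔸ˣ) : 𝔸)‖ ≤ 1 ∧ ‖(((g x)⁻¹ : 𝔸ˣ) : 𝔸)‖ ≤ 1) (V : CfgY 𝔸 i)
    (ιB : BlkY i → IBondY i) (hι : ∀ s, β i.hN i.D i.hk (ιB s) = s) (dB : ℕ) {θ δ α : ℝ} (hθ : 0 ≤ θ) (hδ : 0 ≤ δ) (hα1 : α ≤ 1)
    (h261 : Ineq261 dB (toB6 (geoCK i c) Rr H) δ α)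
    (hT : HasMajorant (g := toB6 (geoCK i c) Rr H) (fun p : SiteY i × ι => blkCubeY i c p.1)
      (conj b ((GpCubeY i c parS V * (deltaPrimeACubeY i c parS V * cutMulY (𝔸 := 𝔸) (chiY i c) - cutMulY (𝔸 := 𝔸) (chiY i c) * deltaPrimeACubeY i c parS V)).restrictScalars ℝ))
      (fun a s => θ * Real.exp (-(δ * (geoCK i c).dist a s)))) :
    HasMajorant (g := toB6 (geo9K i) Rr' Hp) (fun p : SiteY i × ι => ιB (blkOf i.D.toDomains p.1))
      (conj b ((GpCubeY i c parS (gaugeY i g⁻¹ V) * (deltaPrimeACubeY i c parS (gaugeY i g⁻¹ V) * cutMulY (𝔸 := 𝔸) (chiY i c) -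
          cutMulY (𝔸 := 𝔸) (chiY i c) * deltaPrimeACubeY i c parS (gaugeY i g⁻¹ V))).restrictScalars ℝ))
      (fun a a' => (M₂ * ∑ j, ‖b j‖) ^ 2 * ((θ * B6.c1 dB δ α) * Real.exp (-((1 - α) * δ * (geo9K i).dist a a')))) := by
  have hγ : ∀ (z : SiteY i) (a : 𝔸), ‖R (gSiteY i g z) a‖ ≤ ‖a‖ ∧ ‖R (gSiteY i g z)⁻¹ a‖ ≤ ‖a‖ := fun z a =>
    ⟨norm_R_le (hg _).1 (hg _).2 a, norm_R_inv_le (hg _).1 (hg _).2 a⟩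
  set M : Module.End ℝ (SiteY i → 𝔸) := (GpCubeY i c parS V * (deltaPrimeACubeY i c parS V * cutMulY (𝔸 := 𝔸) (chiY i c) -
    cutMulY (𝔸 := 𝔸) (chiY i c) * deltaPrimeACubeY i c parS V)).restrictScalars ℝ with hM
  have hop : ((GpCubeY i c parS (gaugeY i g⁻¹ V) * (deltaPrimeACubeY i c parS (gaugeY i g⁻¹ V) * cutMulY (𝔸 := 𝔸) (chiY i c) -
        cutMulY (𝔸 := 𝔸) (chiY i c) * deltaPrimeACubeY i c parS (gaugeY i g⁻¹ V))).restrictScalars ℝ : Module.End ℝ (SiteY i → 𝔸)) =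
      (cutMulY (𝔸 := 𝔸) (fun _ : SiteY i => (1 : ℝ))).restrictScalars ℝ ∘ₗ (conjY (gSiteY i g)⁻¹).restrictScalars ℝ ∘ₗ M ∘ₗ (conjY (gSiteY i g)).restrictScalars ℝ := by
    rw [commStepAdj_gauge_inv_eq i c hS g V, cutMulY_one_eq]
    exact LinearMap.ext fun _ => rfl
  rw [hop]
  have hT' : HasMajorant (g := toB6 (geoCK i c) Rr H) (fun p : SiteY i × ι => blkCubeY i c p.1) (conj b M)
      (fun a s => θ * (fun _ : BlkCubeY i c => (1 : ℝ)) a * Real.exp (-(δ * (geoCK i c).dist a s))) :=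
    hasMajorant_mono (g := toB6 (geoCK i c) Rr H) _ hT fun a s => le_of_eq (by rw [mul_one])
  refine hasMajorant_conj_site_sandwich_src_global i c b hM₂ hrepr (gSiteY i g) hγ (fun _ : SiteY i => (1 : ℝ)) (fun _ => (1 : ℝ))
    (fun z => by rw [abs_one]) ιB hι Rr H Rr' Hp dB hθ hδ hα1 (fun _ => (1 : ℝ)) (fun _ => zero_le_one) h261 (fun z a' => le_of_eq (by ring)) M hT'

/-- ★★ the same read at F3-E3's `hGK` rate letters: kernel `((M₂Σ‖b_j‖)²θc₁)·e^{−b_Kδ₀·d}` for any `b_K·δ₀ ≤ (1−α)δ`. [cite: Balaban1984PropagatorsII, (2.46) p.231, (2.51) p.232, bookkeeping] -/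
theorem hasMajorant_conj_commStepAdj_member_rate {M₂ : ℝ} (hM₂ : 0 ≤ M₂) (hrepr : ∀ (v : 𝔸) (j : ι), |b.repr v j| ≤ M₂ * ‖v‖)
    {parS : SiteParY 𝔸 i} (hS : IsGaugeLawS i parS) (g : GaugeY 𝔸 i) (hg : ∀ x, ‖((g x : 𝔸ˣ) : 𝔸)‖ ≤ 1 ∧ ‖(((g x)⁻¹ : 𝔸ˣ) : 𝔸)‖ ≤ 1) (V : CfgY 𝔸 i)
    (ιB : BlkY i → IBondY i) (hι : ∀ s, β i.hN i.D i.hk (ιB s) = s) (dB : ℕ) {θ δ α bK δ₀ : ℝ} (hθ : 0 ≤ θ) (hδ : 0 ≤ δ) (hα1 : α ≤ 1)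
    (hrate : bK * δ₀ ≤ (1 - α) * δ) (h261 : Ineq261 dB (toB6 (geoCK i c) Rr H) δ α)
    (hT : HasMajorant (g := toB6 (geoCK i c) Rr H) (fun p : SiteY i × ι => blkCubeY i c p.1)
      (conj b ((GpCubeY i c parS V * (deltaPrimeACubeY i c parS V * cutMulY (𝔸 := 𝔸) (chiY i c) - cutMulY (𝔸 := 𝔸) (chiY i c) * deltaPrimeACubeY i c parS V)).restrictScalars ℝ))
      (fun a s => θ * Real.exp (-(δ * (geoCK i c).dist a s)))) :
    HasMajorant (g := toB6 (geo9K i) Rr' Hp) (fun p : SiteY i × ι => ιB (blkOf i.D.toDomains p.1))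
      (conj b ((GpCubeY i c parS (gaugeY i g⁻¹ V) * (deltaPrimeACubeY i c parS (gaugeY i g⁻¹ V) * cutMulY (𝔸 := 𝔸) (chiY i c) -
          cutMulY (𝔸 := 𝔸) (chiY i c) * deltaPrimeACubeY i c parS (gaugeY i g⁻¹ V))).restrictScalars ℝ))
      (fun a y'' => ((M₂ * ∑ j, ‖b j‖) ^ 2 * (θ * B6.c1 dB δ α)) * Real.exp (-(bK * δ₀ * (geo9K i).dist a y''))) := by
  obtain ⟨-, -, hdnn⟩ := geo9K_axioms i Rr' Hp
  refine hasMajorant_mono (g := toB6 (geo9K i) Rr' Hp) _ (hasMajorant_conj_commStepAdj_member i c b hM₂ hrepr hS g hg V ιB hι dB hθ hδ hα1 h261 hT) fun y a' => ?_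
  rw [← mul_assoc]
  refine mul_le_mul_of_nonneg_left (Real.exp_le_exp.2 (neg_le_neg ?_)) (mul_nonneg (sq_nonneg _) (mul_nonneg hθ (c1_nonneg _ _ _)))
  exact mul_le_mul_of_nonneg_right hrate (hdnn y a')

end Transfer

/-! ## §4  ★★★ F3-E3's `hDR □ ν` with `hGK` DISCHARGED from the cube-side letter -/

section Plug

variable (i : KIdx d ℓ hd hL b₀ b₁) (c : ↥(cubes (toKT i).D.toDomains)) (b : Module.Basis ι ℝ 𝔸)
variable [Fintype (geo9K i).Site] [DecidableEq (geo9K i).Site] {Rr : ℝ} {H : Prop} {Rr' : ℝ} {Hp : Prop}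
variable {B : B9.Backgrounds} (cfg : B.Cfg → CfgY 𝔸 i) {U₁ : B.Cfg}

open Classical in
set_option maxHeartbeats 1600000 in
/-- ★★★ **`hDR □ ν` AT THE (3.35) DATUM WITH THE CUBE LETTER'S KERNEL SUPPLIED**: p38 F3-E3 `hasMajorant_hDR_at` with its displayed `hGK` DISCHARGED by §3 from the
cube-side majorant `hT` of `conj b((G′_□(Ṽ_□)·[Δ′_{a,□}(Ṽ_□), M_{χ_□}])^ℝ) ≺ θ·e^{−δ_c d_□}` (supplied over all members by §2 `commStepAdj_at_datum`), the cube (2.61) at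
`(δ_c, α_c)` and the rate trade `b_K·δ₀ ≤ (1−α_c)δ_c` (`θ_K := (M₂Σ‖b_j‖)²θc₁(dB_c, δ_c, α_c)`):
`conj b((η²·(G′(U₁) − G′_□(Ṽ_□^{u⁻¹}))·M_χl)^ℝ)·conj b(−η⁻¹∇*_ν(U₁)) ≺ ε_D^R·ℓ(a)·e^{−ρδ₀d}`,
`ε_D^R = M₂Σ‖b_j‖B_G(1 + ΛD₁θ∕3)·(e^{−a_sepδ₀(3M_h∕8 − 1)} + θ_KΛ_st·c₁(δ₀, a_G − α − a_sep − ρ)·e^{−a_sepδ₀(3M_h∕8 − 3)})` — the RIGHT twin of p33 E2d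
`hasMajorant_hDL_chiL_of_eBlock`: displayed now only `hE`, `hT □` (cube side, at `Ṽ_□`), the units `hU`∕`hV`, `η = |c_f|⁻¹`, the datum, the transfers, the two (2.61)'s and the budgets.
[cite: Balaban1985BackgroundPropagators, p.415 l.29–31, p.412 l.22–36, (3.100) p.413, (3.88)–(3.89) p.409, (3.31)–(3.33) pp.395–396, Cor. 3.6 p.408, Thm 3.1 (3.42) p.397; Balaban1983RegularityDecay, (1.11)–(1.12) (statement type; derivation ours, Theorem-D road); Balaban1984PropagatorsII, (2.83)–(2.85) pp.237–238, (2.51)–(2.52) p.232, (2.46) p.231, Lemma 2.1 (2.60)–(2.61) p.234] -/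
theorem hasMajorant_hDR_at_of_cube {BG δG : ℝ} (hE : EBlock (kernelFamilySInv i B cfg (GpY i (parSymY i)) (parSymY i)) BG δG U₁) (hBG : 0 ≤ BG)
    (ιB : BlkY i → IBondY i) (hι : ∀ s, β i.hN i.D i.hk (ιB s) = s)
    {M₂ : ℝ} (hM₂ : 0 ≤ M₂) (hrepr : ∀ (v : 𝔸) (j : ι), |b.repr v j| ≤ M₂ * ‖v‖) (hη : etaS i = |i.cf|⁻¹) (ν : Fin (d + 1))
    (g : GaugeY 𝔸 i) (hg : ∀ x, ‖((g x : 𝔸ˣ) : 𝔸)‖ ≤ 1 ∧ ‖(((g x)⁻¹ : 𝔸ˣ) : 𝔸)‖ ≤ 1) (η : ℝ) (A : AfldY 𝔸 i) {Q : Set (Site (PV d ℓ i.m i.K hd hL) 0)}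
    (hQ : ∀ x : Site (PV d ℓ i.m i.K hd hL) 0, NearC i c (35 * SC i c / 8 + 1) (boxEquiv i.hN x).1 → x ∈ Q)
    (hgA : ∀ (κ : Fin (d + 1)) (x : Site (PV d ℓ i.m i.K hd hL) 0), x ∈ Q → x.shift κ ∈ Q → gaugeY i g (cfg U₁) κ x = fluct η A κ x)
    (hU : IsUnit (deltaPrimeAY i (parSymY i) (cfg U₁))) (hV : IsUnit (deltaPrimeACubeY i c (parSymY i) (gaugeY i g⁻¹ (locCfgY i c η A))))
    (dBc : ℕ) {θ δc αc : ℝ} (hθ : 0 ≤ θ) (hδc : 0 ≤ δc) (hαc1 : αc ≤ 1) (h261c : Ineq261 dBc (toB6 (geoCK i c) Rr H) δc αc)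
    (hT : HasMajorant (g := toB6 (geoCK i c) Rr H) (fun p : SiteY i × ι => blkCubeY i c p.1)
      (conj b ((GpCubeY i c (parSymY i) (locCfgY i c η A) * (deltaPrimeACubeY i c (parSymY i) (locCfgY i c η A) * cutMulY (𝔸 := 𝔸) (chiY i c) -
          cutMulY (𝔸 := 𝔸) (chiY i c) * deltaPrimeACubeY i c (parSymY i) (locCfgY i c η A))).restrictScalars ℝ))
      (fun a s => θ * Real.exp (-(δc * (geoCK i c).dist a s))))
    (dB : ℕ) {δ₀ aG α Λ bK αst Λst asep ρ : ℝ} (hδ₀ : 0 ≤ δ₀) (haG : aG * δ₀ ≤ δG) (hα : 0 ≤ α) (hΛ : 0 ≤ Λ)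
    (hT1 : ScaleTransfer (geo9K i) δ₀ α Λ (fun a => (geo9K i).len a)) (hΛst : 0 ≤ Λst)
    (hTst : ScaleTransfer (geo9K i) δ₀ αst Λst (fun a => (geo9K i).len a)) (hasep : 0 ≤ asep) (hρ : 0 ≤ ρ) (hsplitL : αst + ρ ≤ bK)
    (hrate : bK * δ₀ ≤ (1 - αc) * δc)
    (hsplit : α + asep + ρ ≤ aG) (h261 : Ineq261 dB (toB6 (geo9K i) Rr' Hp) δ₀ (aG - α - asep - ρ)) :
    HasMajorant (g := toB6 (geo9K i) Rr' Hp) (fun p : SiteY i × ι => ιB (blkOf i.D.toDomains p.1))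
      (conj b (((etaS i ^ 2) • ((GpY i (parSymY i) (cfg U₁) - GpCubeY i c (parSymY i) (gaugeY i g⁻¹ (locCfgY i c η A))) ∘ₗ
          cutMulY (𝔸 := 𝔸) (bumpY i (ctrR i c) (3 * (SC i c : ℝ))))).restrictScalars ℝ) *
        conj b (diffLetter (shiftY i) (UboxY i (cfg U₁)) (((etaS i : ℝ) : ℂ))⁻¹ (Sum.inr ν)))
      (fun a a' => (M₂ * (∑ j, ‖b j‖) * BG * (1 + Λ * (D1 thetaProf / 3)) *
          (Real.exp (-(asep * δ₀ * (3 / 8 * (i.Mh : ℝ) - 1))) +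
            ((M₂ * ∑ j, ‖b j‖) ^ 2 * (θ * B6.c1 dBc δc αc)) * Λst * B6.c1 dB δ₀ (aG - α - asep - ρ) * Real.exp (-(asep * δ₀ * (3 / 8 * (i.Mh : ℝ) - 3))))) *
        (geo9K i).len a * Real.exp (-(ρ * δ₀ * (geo9K i).dist a a'))) :=
  hasMajorant_hDR_at i c b cfg hE hBG ιB hι hM₂ hrepr hη ν g η A hQ hgA hU hV dB hδ₀ haG hα hΛ hT1
    (mul_nonneg (sq_nonneg _) (mul_nonneg hθ (c1_nonneg _ _ _))) hΛst hTst hasep hρ hsplitL hsplit h261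
    (hasMajorant_conj_commStepAdj_member_rate i c b hM₂ hrepr (parSymY_isGaugeLawS i) g hg (locCfgY i c η A) ιB hι dBc hθ hδc hαc1 hrate h261c hT)

end Plug

end Literature.MathematicalPhysics.QuantumFieldTheory.Balaban1983to89.B9Eq3105FamThreeCommStepAdjAtDatum

end
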